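import Literature.MathematicalPhysics.QuantumFieldTheory.Balaban1983to89.B9Eq386LipschitzH1TowerTwoBackgrounds

/-!
# `Balaban1983to89.B9Eq3153FrakGkLipschitzTowerTwoBackgrounds` — T. Bałaban, *Propagators for lattice gauge theories in a background field*, Commun.
# Math. Phys. **99** (1985) 389–434 [Balaban1985BackgroundPropagators] (3.153) p. 426 with Thm 3.4 p. 400 ∕ (3.86) p. 407 and (3.26) p. 395: AT `k`
# LEVELS AND A FIXED LATTICE THE NE9 CHAIN's `𝔊_k(U) = G₁ − H₁Q_kG₁ − G₁DR_kD*G₁` ((3.153) ∕ [Balaban1985Variational] (111)) FOR PRINT's k-TH-STEP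
# OPERATOR IS LIPSCHITZ IN THE BACKGROUND BETWEEN TWO SMALL BACKGROUNDS — `‖𝔊_k(U)x − 𝔊_k(U′)x‖ ≤ C₃·δ·‖x‖`: the one-step (Q3)₂
# `B9Eq3153FrakGLipschitzTwoBackgrounds` (this lineage, gen 73) ONE STOREY UP, by the telescoping of `B9Eq386ResolventLetters` on the k-level
# two-background letters of `G₁, H₁` ((Q2)₂-k), `Q_k` (`B9Eq315QTowerLipschitzTwoBackgrounds`), `D, D*` ((B)₂ on the finest lattice), `R_k` ((Q3a)₂-k)

statement-level skeleton of published theorems with citation tags; proofs where landed; nothing here is a claim about the Yang–Mills mass gap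

PDF held: `paper:balaban1985-cmp99-background-propagators` (journal page = PDF page + 388); pp. 400, 407, 425–426 through the verbatim quotations of
`B9Eq3153FrakGLipschitz` (NE9 owner gen 81), whose proof this file runs between two backgrounds at `k` levels.

CITATION HEADER (lean-in-tree rule 2026-08-18).  Audit cell `pub-balaban`, sub-cell `t4`, NE9 crux team (2): LEAF PROVER 04
(`b2b-balaban-t4-ne9-formalise-leaf-04` gen 74) — TOWER-SPECIES-PLAN §2 (e), the fourth junction above the k-level two-background averaging letters;
with it every letter of the owner's k-level (B′)-storey (`𝔊_k`, `H_{1,k}`) has a two-background Lipschitz bound in the tree.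

THE PRINT (as quoted in `B9Eq3153FrakGLipschitz` ∕ `B9Eq386LipschitzH1`).  p. 400, Thm 3.4: *«… small perturbations of the operators depending on U
only»*; (3.86) p. 407; (3.153) p. 426 (the operator `𝔊`); [Balaban1985Variational] (110)–(111) p. 294; print's `k`-level composite `Q` of (3.15).

WHAT IS PROVED (sorry-free; no `Prop` placeholder; no inequality of the paper asserted).
* **`exists_lipschitz_frakGk_twoBackgrounds`** — for two tower profiles `α, α′` (`α_j, α′_j ≤ 1∕64`, FIXED before the `∃`): `∃ C₃ ε₈ > 0 ∀ U U′` on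
  `T_{L^{n+1} m}` with their tower data (`hU1 hreg hα2 hα128` ∕ primed), bonds AND level averages `U1`-valued, `ε`-small (`ε ≤ ε₈`), `δ`-close, `hRS`,
  `hRS′`, `∀ hpos hQ` (at `U`) `∀ hpos′ hQ′` (at `U′`) `∀ x`: `‖𝔊_k(U)x − 𝔊_k(U′)x‖ ≤ C₃·δ·‖x‖` for `frakGLatticeK` at `Δ₁ := hessOp φ η V τ`,
  `Q := QkW … V …` — `B9Eq386ResolventLetters.norm_frakG_formula_sub_le` with the BOUNDS `‖G₁(V)‖ ≤ γ₁⁻¹` (`norm_G1k_le_of_coercive` on the sections-free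
  k-level coercivity at each profile, `γ₁ = min`), `‖H₁(U′)‖ ≤ C_H` (sections-free `exists_H1k_frakGk_bound_of_small_field'` at `α′`), `‖Q_k(V)‖ ≤ ‖Q_k(1)‖ + C_Q`,
  `‖D‖, ‖D*‖ ≤ 4|η|⁻¹√d`, `‖R_k‖ ≤ 1` at both backgrounds — the `ρ′`∕`δ_Q` slots of the two small-field suppliers discharged by the owner's
  `norm_QprimeTowerW_sub_flat_le` (majorised `C_ρK_Rε`) and `norm_QkW_sub_flat_le` (`C_Qε`) — and the DIFFERENCES `δ_G = C₁δ`, `δ_H = C₂δ` ((Q2)₂-k),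
  `δ_Q = C_{Q,2}·δ` (`norm_QkW_sub_QkW_le`, `δ ∧ 2ε`), `δ_D = |η|⁻¹·2M_φM_φ′δ·√d` ((B)₂), `δ_R = C_R·δ` ((Q3a)₂-k).
MODEL / HONEST SCOPE.  [folklore] finite-dimensional perturbation theory at a FIXED lattice and number of levels; `C₃, ε₈` depend on `L, m, n, η, c₀, c₁, a,
M_φ, M_φ′, C_τ` and on the two profiles (exponential in the number of levels, volume-dependent through `√|𝔅(T_m)|` and (Q3a)₂-k's `C_S`); both
backgrounds AND their level averages in the small ball (DISPLAYED); NOT analyticity in `A`, NOT uniformity in the lattice or in `k`; NOT summit progress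
(cell pub-balaban: NE9 NOT PRINTED ∕ NOT PROVED; spine PROVED 0∕9; rung (B)+1 finite T⁴ — NOT infinite volume, NOT mass gap, NOT BetaPertH, NOT Clay).
NEW file importing `B9Eq386LipschitzH1TowerTwoBackgrounds` only; nothing of the NE9-owner ∕ leaf-02 lineages' files is modified.  Net new unproved facts: 0.
-/

noncomputable section

open scoped InnerProductSpace ComplexConjugate

namespace Literature.MathematicalPhysics.QuantumFieldTheory.Balaban1983to89.B9Eq3153FrakGkLipschitzTowerTwoBackgrounds

open B4Sect5Torus (TSite)
open B9SectCLatticeCarrier (Bond)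
open B7Prop1Explicit (U1 Wcx boxVec)
open B9Eq311L2Pairing (WL2)
open B9Eq319QprimeTorus (fineP)
open B11Eq103H1Complex (SiteL2K BondL2K covDerivL2K covDivL2K laplaceAK laplaceALatticeK H1LatticeK G1LatticeK KinvLatticeK frakGLatticeK RLatticeK)
open B9Eq310HessianOperator (adTransportW hessOp)
open B9Eq315QTorus (perCfg cornerSite)
open B9Eq315QTower (towerP UlevOf)
open B9Eq315QTowerFlat (perCfg_UlevOf_one_mem_U1 norm_Wcx_UlevOf_one_sub_one_le)
open B9Eq326OperatorTower (RofUk QkW QprimeTowerW laplaceAk)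
open B9Eq368ProjectionRemainder (norm_projR_le)
open B9Eq373DerivativeRemainderL2 (norm_covDerivL2K_le norm_covDivL2K_le)
open B9Eq373DerivativeRemainderTwoBackgrounds (norm_covDerivL2K_sub_le₂ norm_covDivL2K_sub_le₂)
open B9Eq384RemainderLetters (norm_adTransportW_sub_le)
open B9Eq368RLipschitzTwoBackgrounds (norm_adTransportW_sub_adTransportW_le)
open B9Eq368RLipschitzTowerTwoBackgrounds (exists_RofUk_sub_RofUk_linear)
open B9Eq315QTowerLipschitz (norm_QkW_sub_flat_le norm_QprimeTowerW_sub_flat_le)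
open B9Eq315QTowerLipschitzTwoBackgrounds (norm_QkW_sub_QkW_le)
open B9Eq3126H1BoundTower (exists_coercive_laplaceAk_of_small_field' norm_G1k_le_of_coercive exists_H1k_frakGk_bound_of_small_field')
open B9Eq386ResolventLetters (norm_frakG_formula_sub_le)
open B9Eq386LipschitzH1TowerTwoBackgrounds (exists_lipschitz_G1k_H1k_twoBackgrounds)

/-- `K^N − 1 ≤ N(K − 1)K^N` for `K ≥ 1` (the tower's linear majorant; private copy). [folklore] -/
private theorem pow_sub_one_le_mul_pow {K : ℝ} (hK : 1 ≤ K) : ∀ N : ℕ, K ^ N - 1 ≤ N * (K - 1) * K ^ N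
  | 0 => by simp
  | N + 1 => by
    have ih := pow_sub_one_le_mul_pow hK N
    have hK0 : 0 ≤ K := by linarith
    have hKN1 : 1 ≤ K ^ (N + 1) := one_le_pow₀ hK
    calc K ^ (N + 1) - 1 = K * (K ^ N - 1) + (K - 1) := by ring
      _ ≤ K * ((N : ℝ) * (K - 1) * K ^ N) + (K - 1) * K ^ (N + 1) :=
          add_le_add (mul_le_mul_of_nonneg_left ih hK0) (le_mul_of_one_le_right (by linarith) hKN1)
      _ = ((N + 1 : ℕ) : ℝ) * (K - 1) * K ^ (N + 1) := by push_cast; ring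

variable {d : ℕ} (L : ℕ) [NeZero L] (m : Fin d → ℕ) [∀ i, NeZero (m i)] (n : ℕ) (hL : 1 ≤ L)
  {𝔸 : Type*} [NormedRing 𝔸] [NormedAlgebra ℂ 𝔸] [CompleteSpace 𝔸] [NormOneClass 𝔸] [StarRing 𝔸] [NormedStarGroup 𝔸] [StarModule ℂ 𝔸]
  {W : Type*} [NormedAddCommGroup W] [InnerProductSpace ℂ W] [FiniteDimensional ℂ W] (φ : W ≃ₗ[ℂ] 𝔸) {c₀ c₁ : ℝ} [Fact (0 < c₀)] [Fact (0 < c₁)]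

set_option maxHeartbeats 800000 in
/-- **`𝔊_k(U)` ((3.153)∕(111) FOR PRINT's k-TH-STEP OPERATOR) IS LIPSCHITZ IN THE BACKGROUND BETWEEN TWO SMALL BACKGROUNDS: `‖𝔊_k(U)x − 𝔊_k(U′)x‖ ≤
C₃·δ·‖x‖`** for the chain's `frakGLatticeK` at `Δ₁ := hessOp φ η V τ`, `Q := QkW … V …` (ANY positivity ∕ surjectivity witnesses at `U` and at `U′`),
at every pair of backgrounds with their tower data (profiles FIXED before `∃`), bonds and level averages `U1`-valued, `ε`-small (`ε ≤ ε₈`), `δ`-close,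
`hRS`, `hRS′` — the owner's (Q3) proof with `U′` for `1`, one storey up: bounds at both backgrounds, differences `δ_G = C₁δ`, `δ_H = C₂δ` ((Q2)₂-k),
`δ_Q = C_{Q,2}·δ`, `δ_D = |η|⁻¹2M_φM_φ′δ√d` ((B)₂), `δ_R = C_R·δ` ((Q3a)₂-k), the telescoping `norm_frakG_formula_sub_le`.
[cite: Balaban1985BackgroundPropagators, (3.153) p.426, (3.147) p.425, Thm 3.4 p.400, (3.86) p.407, (3.26) p.395; Balaban1985Variational, (110)–(111) p.294] -/
theorem exists_lipschitz_frakGk_twoBackgrounds {η : ℝ} (hη : η ≠ 0) {a : ℝ} (ha : 0 < a) {Mφ Mφ' : ℝ} (hMφ : 0 ≤ Mφ) (hMφ' : 0 ≤ Mφ')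
    (hφ : ∀ w, ‖φ w‖ ≤ Mφ * ‖w‖) (hφ' : ∀ X, ‖φ.symm X‖ ≤ Mφ' * ‖X‖) (τ : 𝔸 →ₗ[ℂ] ℂ) {Cτ : ℝ} (hτ : ∀ X, ‖τ X‖ ≤ Cτ * ‖X‖) (hCτ : 0 ≤ Cτ)
    (α α' : ℕ → ℝ) (hα1 : ∀ j, α j ≤ 1 / 64) (hα1' : ∀ j, α' j ≤ 1 / 64) :
    ∃ C₃ ε₈ : ℝ, 0 < C₃ ∧ 0 < ε₈ ∧ ∀ (U U' : Bond d (towerP L m (n + 1)) → 𝔸ˣ)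
      (hU1 : ∀ (j : ℕ) (x : B7Prop1Explicit.Site d) (κ : Fin d), perCfg (towerP L m (j + 1)) (UlevOf L m (n + 1) U j) x κ ∈ U1 𝔸)
      (hreg : ∀ (j : ℕ) (y : TSite d (towerP L m j)) (κ : Fin d) (r : Fin d → Fin L),
        ‖((Wcx L (perCfg (towerP L m (j + 1)) (UlevOf L m (n + 1) U j)) (cornerSite L y) κ (boxVec L r) : 𝔸ˣ) : 𝔸) - 1‖ ≤ α j)
      (hα2 : ∀ j, 50 * (d + 1) * α j ≤ 1) (hα128 : ∀ j, α j ≤ 1 / 128)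
      (hU1' : ∀ (j : ℕ) (x : B7Prop1Explicit.Site d) (κ : Fin d), perCfg (towerP L m (j + 1)) (UlevOf L m (n + 1) U' j) x κ ∈ U1 𝔸)
      (hreg' : ∀ (j : ℕ) (y : TSite d (towerP L m j)) (κ : Fin d) (r : Fin d → Fin L),
        ‖((Wcx L (perCfg (towerP L m (j + 1)) (UlevOf L m (n + 1) U' j)) (cornerSite L y) κ (boxVec L r) : 𝔸ˣ) : 𝔸) - 1‖ ≤ α' j)
      (hα2' : ∀ j, 50 * (d + 1) * α' j ≤ 1) (hα128' : ∀ j, α' j ≤ 1 / 128)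
      {ε δ : ℝ}, 0 ≤ ε → ε ≤ ε₈ → 0 ≤ δ →
      (∀ b, U b ∈ U1 𝔸) → (∀ b, U' b ∈ U1 𝔸) → (∀ b, ‖(U b : 𝔸) - 1‖ ≤ ε) → (∀ b, ‖(U' b : 𝔸) - 1‖ ≤ ε) →
      (∀ b, ‖(U b : 𝔸) - (U' b : 𝔸)‖ ≤ δ) →
      (∀ (b : Bond d (towerP L m (n + 1))) (v u : W), ⟪adTransportW φ U b v, u⟫_ℂ = ⟪v, adTransportW φ (fun b => (U b)⁻¹) b u⟫_ℂ) →
      (∀ (b : Bond d (towerP L m (n + 1))) (v u : W), ⟪adTransportW φ U' b v, u⟫_ℂ = ⟪v, adTransportW φ (fun b => (U' b)⁻¹) b u⟫_ℂ) →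
      (∀ (j : ℕ) (b : Bond d (towerP L m (j + 1))), UlevOf L m (n + 1) U j b ∈ U1 𝔸) →
      (∀ (j : ℕ) (b : Bond d (towerP L m (j + 1))), UlevOf L m (n + 1) U' j b ∈ U1 𝔸) →
      (∀ (j : ℕ) (b : Bond d (towerP L m (j + 1))), ‖((UlevOf L m (n + 1) U j b : 𝔸ˣ) : 𝔸) - 1‖ ≤ ε) →
      (∀ (j : ℕ) (b : Bond d (towerP L m (j + 1))), ‖((UlevOf L m (n + 1) U' j b : 𝔸ˣ) : 𝔸) - 1‖ ≤ ε) →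
      (∀ (j : ℕ) (b : Bond d (towerP L m (j + 1))),
        ‖((UlevOf L m (n + 1) U j b : 𝔸ˣ) : 𝔸) - ((UlevOf L m (n + 1) U' j b : 𝔸ˣ) : 𝔸)‖ ≤ δ) →
      ∀ (hpos : ∀ x : BondL2K ℂ d (towerP L m (n + 1)) c₀ W, x ≠ 0 →
          0 < RCLike.re ⟪x, laplaceAk L m n φ η U hL α hα1 hU1 hreg τ (c₀ := c₀) (c₁ := c₁) a x⟫_ℂ)
        (hQ : Function.Surjective (QkW L m n φ U hL α hα1 hU1 hreg (c₀ := c₀) (c₁ := c₁)))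
        (hpos' : ∀ x : BondL2K ℂ d (towerP L m (n + 1)) c₀ W, x ≠ 0 →
          0 < RCLike.re ⟪x, laplaceAk L m n φ η U' hL α' hα1' hU1' hreg' τ (c₀ := c₀) (c₁ := c₁) a x⟫_ℂ)
        (hQ' : Function.Surjective (QkW L m n φ U' hL α' hα1' hU1' hreg' (c₀ := c₀) (c₁ := c₁))) (x : BondL2K ℂ d (towerP L m (n + 1)) c₀ W),
      ‖frakGLatticeK (Δ₁ := hessOp φ η U τ) (Q := QkW L m n φ U hL α hα1 hU1 hreg (c₀ := c₀) (c₁ := c₁)) hpos hQ x -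
          frakGLatticeK (Δ₁ := hessOp φ η U' τ) (Q := QkW L m n φ U' hL α' hα1' hU1' hreg' (c₀ := c₀) (c₁ := c₁)) hpos' hQ' x‖ ≤
        C₃ * δ * ‖x‖ := by
  have hc₀ : 0 < c₀ := Fact.out
  have hc : conj ((η : ℂ))⁻¹ = ((η : ℂ))⁻¹ := by rw [map_inv₀, Complex.conj_ofReal]
  have hL0 : (0 : ℝ) < L := by exact_mod_cast hL
  -- the letters' uniform bounds and two-background differences (k-level suppliers, sections-free)
  obtain ⟨γa, ε₃a, hγa, hε₃a, Hca⟩ :=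
    exists_coercive_laplaceAk_of_small_field' L m n hL φ (c₀ := c₀) (c₁ := c₁) α hα1 hη ha hMφ hMφ' hφ hφ' τ hτ hCτ
  obtain ⟨γb, ε₃b, hγb, hε₃b, Hcb⟩ :=
    exists_coercive_laplaceAk_of_small_field' L m n hL φ (c₀ := c₀) (c₁ := c₁) α' hα1' hη ha hMφ hMφ' hφ hφ' τ hτ hCτ
  obtain ⟨γ₁, hγ₁def⟩ : ∃ γ₁ : ℝ, γ₁ = min γa γb := ⟨_, rfl⟩
  have hγ₁ : 0 < γ₁ := by rw [hγ₁def]; exact lt_min hγa hγb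
  obtain ⟨ε₃, hε₃def⟩ : ∃ ε₃ : ℝ, ε₃ = min ε₃a ε₃b := ⟨_, rfl⟩
  have hε₃ : 0 < ε₃ := by rw [hε₃def]; exact lt_min hε₃a hε₃b
  obtain ⟨CH, CG', ε₅, hCH, -, hε₅, Hb⟩ :=
    exists_H1k_frakGk_bound_of_small_field' L m n hL φ (c₀ := c₀) (c₁ := c₁) α' hα1' hη ha hMφ hMφ' hφ hφ' τ hτ hCτ
  obtain ⟨C₁, C₂, ε₇, hC₁, hC₂, hε₇, HGH⟩ :=
    exists_lipschitz_G1k_H1k_twoBackgrounds L m n hL φ (c₀ := c₀) (c₁ := c₁) hη ha hMφ hMφ' hφ hφ' τ hτ hCτ α α' hα1 hα1'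
  obtain ⟨CR, εR₀, hCR, hεR₀, HR⟩ := exists_RofUk_sub_RofUk_linear L m n φ (c₀ := c₀) hη hMφ hMφ' hφ hφ'
  -- constants
  obtain ⟨MQ1, hMQ1def⟩ : ∃ MQ1 : ℝ, MQ1 = ‖LinearMap.toContinuousLinearMap
    (QkW L m n φ (fun _ : Bond d (towerP L m (n + 1)) => (1 : 𝔸ˣ)) hL (fun _ => 0) (fun _ => by norm_num) (perCfg_UlevOf_one_mem_U1 L m (n + 1)) (norm_Wcx_UlevOf_one_sub_one_le L m (n + 1) (fun _ => 0) (fun _ => le_rfl)) (c₀ := c₀) (c₁ := c₁))‖ := ⟨_, rfl⟩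
  have hMQ1 : 0 ≤ MQ1 := by rw [hMQ1def]; positivity
  have hQ1 : ∀ x : BondL2K ℂ d (towerP L m (n + 1)) c₀ W,
      ‖QkW L m n φ (fun _ : Bond d (towerP L m (n + 1)) => (1 : 𝔸ˣ)) hL (fun _ => 0) (fun _ => by norm_num) (perCfg_UlevOf_one_mem_U1 L m (n + 1)) (norm_Wcx_UlevOf_one_sub_one_le L m (n + 1) (fun _ => 0) (fun _ => le_rfl)) (c₀ := c₀) (c₁ := c₁) x‖ ≤ MQ1 * ‖x‖ :=
    fun x => by
      rw [hMQ1def]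
      exact (LinearMap.toContinuousLinearMap
        (QkW L m n φ (fun _ : Bond d (towerP L m (n + 1)) => (1 : 𝔸ˣ)) hL (fun _ => 0) (fun _ => by norm_num) (perCfg_UlevOf_one_mem_U1 L m (n + 1)) (norm_Wcx_UlevOf_one_sub_one_le L m (n + 1) (fun _ => 0) (fun _ => le_rfl)) (c₀ := c₀) (c₁ := c₁))).le_opNorm x
  obtain ⟨KR, hKRdef⟩ : ∃ KR : ℝ, KR = 2 * Mφ * Mφ' := ⟨_, rfl⟩
  have hKR : 0 ≤ KR := by rw [hKRdef]; positivity
  obtain ⟨N, hNdef⟩ : ∃ N : ℝ, N = ((2 * (d * L) + L + L : ℕ) : ℝ) := ⟨_, rfl⟩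
  have hN1 : (1 : ℝ) ≤ N := by
    have : 1 ≤ 2 * (d * L) + L + L := by omega
    rw [hNdef]; exact_mod_cast this
  have hN : 0 < N := by linarith
  have h2n : (0 : ℝ) ≤ 2 ^ (n + 1) - 1 := sub_nonneg.2 (one_le_pow₀ (by norm_num))
  obtain ⟨CQ, hCQdef⟩ : ∃ CQ : ℝ, CQ = Mφ' * Mφ * Real.sqrt (c₁ * Fintype.card (Bond d m) / c₀) *
      ((2 ^ (n + 1) - 1) * (102 * ((d : ℝ) + 1) ^ 2 * L)) := ⟨_, rfl⟩
  have hCQ : 0 ≤ CQ := by rw [hCQdef]; positivity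
  obtain ⟨CQ₂, hCQ₂def⟩ : ∃ CQ₂ : ℝ, CQ₂ = Mφ' * Mφ * Real.sqrt (c₁ * Fintype.card (Bond d m) / c₀) *
      (((n : ℝ) + 1) * 2 ^ (n + 1) * (75497472 * ((d : ℝ) + 1) * N)) := ⟨_, rfl⟩
  have hCQ₂ : 0 ≤ CQ₂ := by rw [hCQ₂def]; positivity
  obtain ⟨Cρ, hCρdef⟩ : ∃ Cρ : ℝ, Cρ = ((n : ℝ) + 1) * (d * (L - 1) : ℕ) * 2 ^ (d * (L - 1) * (n + 2)) * (Real.sqrt c₀)⁻¹ := ⟨_, rfl⟩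
  have hCρ : 0 ≤ Cρ := by rw [hCρdef]; positivity
  obtain ⟨MD, hMDdef⟩ : ∃ MD : ℝ, MD = 2 * (1 + 1) * ‖((η : ℂ))⁻¹‖ * Real.sqrt d := ⟨_, rfl⟩
  have hMD : 0 ≤ MD := by rw [hMDdef]; positivity
  obtain ⟨KD, hKDdef⟩ : ∃ KD : ℝ, KD = ‖((η : ℂ))⁻¹‖ * KR * Real.sqrt d := ⟨_, rfl⟩
  have hKD : 0 ≤ KD := by rw [hKDdef]; positivity
  refine ⟨C₁ + (C₂ * (MQ1 + CQ) * γ₁⁻¹ + CH * CQ₂ * γ₁⁻¹ + CH * (MQ1 + CQ) * C₁) +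
      (C₁ * MD * MD * γ₁⁻¹ + γ₁⁻¹ * KD * MD * γ₁⁻¹ + γ₁⁻¹ * MD * CR * MD * γ₁⁻¹ + γ₁⁻¹ * MD * KD * γ₁⁻¹ + γ₁⁻¹ * MD * MD * C₁),
    min (ε₃ / (Cρ * KR + CQ + 2)) (min (1 / (KR + 1)) (min 1 (min (ε₅ / (Cρ * KR + CQ + 2)) (min ε₇ (min εR₀ (1 / (24576 * N))))))),
    by positivity, by positivity, ?_⟩
  intro U U' hU1 hreg hα2 hα128 hU1' hreg' hα2' hα128' ε δ hε hε₈ hδ hUb hU'b hUε hU'ε hUU' hRS hRS' hLb hL'b hLε hL'ε hLL'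
    hpos hQs hpos' hQs' x
  have hεε₃' : ε ≤ ε₃ / (Cρ * KR + CQ + 2) := hε₈.trans (min_le_left _ _)
  have hε1' : ε ≤ 1 / (KR + 1) := hε₈.trans ((min_le_right _ _).trans (min_le_left _ _))
  have hε1 : ε ≤ 1 := hε₈.trans ((min_le_right _ _).trans ((min_le_right _ _).trans (min_le_left _ _)))
  have hεε₅' : ε ≤ ε₅ / (Cρ * KR + CQ + 2) :=
    hε₈.trans ((min_le_right _ _).trans ((min_le_right _ _).trans ((min_le_right _ _).trans (min_le_left _ _))))
  have hεε₇ : ε ≤ ε₇ :=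
    hε₈.trans ((min_le_right _ _).trans ((min_le_right _ _).trans ((min_le_right _ _).trans ((min_le_right _ _).trans (min_le_left _ _)))))
  have hεεR₀ : ε ≤ εR₀ := hε₈.trans ((min_le_right _ _).trans ((min_le_right _ _).trans ((min_le_right _ _).trans ((min_le_right _ _).trans
    ((min_le_right _ _).trans (min_le_left _ _))))))
  have hεN' : ε ≤ 1 / (24576 * N) := hε₈.trans ((min_le_right _ _).trans ((min_le_right _ _).trans ((min_le_right _ _).trans
    ((min_le_right _ _).trans ((min_le_right _ _).trans (min_le_right _ _))))))
  have hεR1 : KR * ε ≤ 1 := by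
    refine (mul_le_mul_of_nonneg_left hε1' hKR).trans ?_
    rw [mul_one_div, div_le_one (by positivity)]; linarith
  -- the effective distance `δ₀ = δ ∧ 2ε` for the two-background `δ_Q`
  obtain ⟨δ₀, hδ₀def⟩ : ∃ δ₀ : ℝ, δ₀ = min δ (2 * ε) := ⟨_, rfl⟩
  have hδ₀ : 0 ≤ δ₀ := by rw [hδ₀def]; exact le_min hδ (by positivity)
  have hδ₀δ : δ₀ ≤ δ := by rw [hδ₀def]; exact min_le_left _ _
  have hδ₀N : δ₀ ≤ 1 / (12288 * ((2 * (d * L) + L + L : ℕ) : ℝ)) := by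
    rw [← hNdef]
    refine (show δ₀ ≤ 2 * ε by rw [hδ₀def]; exact min_le_right _ _).trans ?_
    have := mul_le_mul_of_nonneg_left hεN' (by norm_num : (0 : ℝ) ≤ 2)
    refine this.trans (le_of_eq ?_)
    field_simp; norm_num
  have hLL'₀ : ∀ (j : ℕ) (b : Bond d (towerP L m (j + 1))),
      ‖((UlevOf L m (n + 1) U j b : 𝔸ˣ) : 𝔸) - ((UlevOf L m (n + 1) U' j b : 𝔸ˣ) : 𝔸)‖ ≤ δ₀ := fun j b => by
    rw [hδ₀def]
    refine le_min (hLL' j b) ?_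
    calc ‖((UlevOf L m (n + 1) U j b : 𝔸ˣ) : 𝔸) - ((UlevOf L m (n + 1) U' j b : 𝔸ˣ) : 𝔸)‖
        = ‖(((UlevOf L m (n + 1) U j b : 𝔸ˣ) : 𝔸) - 1) - (((UlevOf L m (n + 1) U' j b : 𝔸ˣ) : 𝔸) - 1)‖ := by rw [sub_sub_sub_cancel_right]
      _ ≤ ‖((UlevOf L m (n + 1) U j b : 𝔸ˣ) : 𝔸) - 1‖ + ‖((UlevOf L m (n + 1) U' j b : 𝔸ˣ) : 𝔸) - 1‖ := norm_sub_le _ _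
      _ ≤ 2 * ε := by linarith [hLε j b, hL'ε j b]
  -- the finest-lattice bond variables: transporters `K_Rε`-close to the identity, `K_Rδ`-close to each other
  have hR : ∀ (b : Bond d (towerP L m (n + 1))) (w : W), ‖adTransportW φ U b w - w‖ ≤ KR * ε * ‖w‖ := fun b w => by
    have h := norm_adTransportW_sub_le φ hφ hφ' hMφ' U b (hUb b) (hUε b) w
    rw [hKRdef]; linarith
  have hR' : ∀ (b : Bond d (towerP L m (n + 1))) (w : W), ‖adTransportW φ U' b w - w‖ ≤ KR * ε * ‖w‖ := fun b w => by
    have h := norm_adTransportW_sub_le φ hφ hφ' hMφ' U' b (hU'b b) (hU'ε b) w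
    rw [hKRdef]; linarith
  have hR1 : ∀ (b : Bond d (towerP L m (n + 1))) (w : W), ‖adTransportW φ U b w - w‖ ≤ 1 * ‖w‖ := fun b w =>
    (hR b w).trans (mul_le_mul_of_nonneg_right hεR1 (norm_nonneg _))
  have hR'1 : ∀ (b : Bond d (towerP L m (n + 1))) (w : W), ‖adTransportW φ U' b w - w‖ ≤ 1 * ‖w‖ := fun b w =>
    (hR' b w).trans (mul_le_mul_of_nonneg_right hεR1 (norm_nonneg _))
  have hRR' : ∀ (b : Bond d (towerP L m (n + 1))) (w : W), ‖adTransportW φ U b w - adTransportW φ U' b w‖ ≤ KR * δ * ‖w‖ := fun b w => by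
    have h := norm_adTransportW_sub_adTransportW_le L (towerP L m n) φ hφ hφ' hMφ' U U' b (hUb b) (hU'b b) (hUU' b) w
    have e : 2 * Mφ * Mφ' * δ * ‖w‖ = KR * δ * ‖w‖ := by rw [hKRdef]
    exact h.trans e.le
  -- `Q_k(V)` against `Q_k(1)` (flat `δ_Q`) and the operator bound `‖Q_k(V)‖ ≤ ‖Q_k(1)‖ + C_Q`, at `U` and at `U′`
  have hQdiff : ∀ (V : Bond d (towerP L m (n + 1)) → 𝔸ˣ) (β : ℕ → ℝ) (hβ : ∀ j, β j ≤ 1 / 64)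
      (hV1 : ∀ (j : ℕ) (x : B7Prop1Explicit.Site d) (κ : Fin d), perCfg (towerP L m (j + 1)) (UlevOf L m (n + 1) V j) x κ ∈ U1 𝔸)
      (hregV : ∀ (j : ℕ) (y : TSite d (towerP L m j)) (κ : Fin d) (r : Fin d → Fin L),
        ‖((Wcx L (perCfg (towerP L m (j + 1)) (UlevOf L m (n + 1) V j)) (cornerSite L y) κ (boxVec L r) : 𝔸ˣ) : 𝔸) - 1‖ ≤ β j)
      (hβ2 : ∀ j, 50 * (d + 1) * β j ≤ 1),
      (∀ (j : ℕ) (b : Bond d (towerP L m (j + 1))), ‖((UlevOf L m (n + 1) V j b : 𝔸ˣ) : 𝔸) - 1‖ ≤ ε) →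
      ∀ x : BondL2K ℂ d (towerP L m (n + 1)) c₀ W, ‖QkW L m n φ V hL β hβ hV1 hregV (c₁ := c₁) x -
      QkW L m n φ (fun _ : Bond d (towerP L m (n + 1)) => (1 : 𝔸ˣ)) hL (fun _ => 0) (fun _ => by norm_num) (perCfg_UlevOf_one_mem_U1 L m (n + 1)) (norm_Wcx_UlevOf_one_sub_one_le L m (n + 1) (fun _ => 0) (fun _ => le_rfl)) (c₁ := c₁) x‖ ≤ CQ * ε * ‖x‖ := by
    intro V β hβ hV1 hregV hβ2 hVLε x
    refine (norm_QkW_sub_flat_le L m n hL φ hMφ hMφ' hφ hφ' V β hβ hV1 hregV hβ2 hε hVLε (c₁ := c₁) x).trans (le_of_eq ?_)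
    rw [hCQdef]; ring
  have hQV : ∀ (V : Bond d (towerP L m (n + 1)) → 𝔸ˣ) (β : ℕ → ℝ) (hβ : ∀ j, β j ≤ 1 / 64)
      (hV1 : ∀ (j : ℕ) (x : B7Prop1Explicit.Site d) (κ : Fin d), perCfg (towerP L m (j + 1)) (UlevOf L m (n + 1) V j) x κ ∈ U1 𝔸)
      (hregV : ∀ (j : ℕ) (y : TSite d (towerP L m j)) (κ : Fin d) (r : Fin d → Fin L),
        ‖((Wcx L (perCfg (towerP L m (j + 1)) (UlevOf L m (n + 1) V j)) (cornerSite L y) κ (boxVec L r) : 𝔸ˣ) : 𝔸) - 1‖ ≤ β j)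
      (hβ2 : ∀ j, 50 * (d + 1) * β j ≤ 1),
      (∀ (j : ℕ) (b : Bond d (towerP L m (j + 1))), ‖((UlevOf L m (n + 1) V j b : 𝔸ˣ) : 𝔸) - 1‖ ≤ ε) → ∀ x : BondL2K ℂ d (towerP L m (n + 1)) c₀ W, ‖QkW L m n φ V hL β hβ hV1 hregV (c₀ := c₀) (c₁ := c₁) x‖ ≤ (MQ1 + CQ) * ‖x‖ := by
    intro V β hβ hV1 hregV hβ2 hVLε x
    have h1 := hQ1 x
    have h2 := hQdiff V β hβ hV1 hregV hβ2 hVLε x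
    have h3 := norm_le_insert' (QkW L m n φ V hL β hβ hV1 hregV (c₀ := c₀) (c₁ := c₁) x)
      (QkW L m n φ (fun _ : Bond d (towerP L m (n + 1)) => (1 : 𝔸ˣ)) hL (fun _ => 0) (fun _ => by norm_num) (perCfg_UlevOf_one_mem_U1 L m (n + 1)) (norm_Wcx_UlevOf_one_sub_one_le L m (n + 1) (fun _ => 0) (fun _ => le_rfl)) (c₀ := c₀) (c₁ := c₁) x)
    have h4 : CQ * ε * ‖x‖ ≤ CQ * ‖x‖ := mul_le_mul_of_nonneg_right (mul_le_of_le_one_right hCQ hε1) (norm_nonneg x)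
    linarith
  have hQU := hQV U α hα1 hU1 hreg hα2 hLε
  have hQU' := hQV U' α' hα1' hU1' hreg' hα2' hL'ε
  -- the `ρ′_k`-letters of the two backgrounds against the flat tower, majorised linearly in `ε`
  have hK1 : (1 : ℝ) ≤ (1 + KR * ε) ^ (d * (L - 1)) := one_le_pow₀ (by linarith [mul_nonneg hKR hε])
  have hmaj1 : (((1 + KR * ε) ^ (d * (L - 1))) ^ (n + 1) - 1) * (Real.sqrt c₀)⁻¹ ≤ Cρ * (KR * ε) := by
    rw [hCρdef]
    have hεR0 : 0 ≤ KR * ε := mul_nonneg hKR hε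
    have h1 := pow_sub_one_le_mul_pow hK1 (n + 1)
    have h2 : (1 + KR * ε) ^ (d * (L - 1)) - 1 ≤ (d * (L - 1) : ℕ) * (KR * ε) * (1 + KR * ε) ^ (d * (L - 1)) :=
      B9Eq319QprimeLipschitz.rho_le L (d := d) hεR0
    have h3 : ((1 + KR * ε) ^ (d * (L - 1))) ^ (n + 1) * (1 + KR * ε) ^ (d * (L - 1)) ≤ (2 : ℝ) ^ (d * (L - 1) * (n + 2)) := by
      rw [← pow_succ, ← pow_mul]
      exact pow_le_pow_left₀ (by positivity) (by linarith) _
    have h4 : ((1 + KR * ε) ^ (d * (L - 1))) ^ (n + 1) - 1 ≤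
        ((n : ℝ) + 1) * (d * (L - 1) : ℕ) * 2 ^ (d * (L - 1) * (n + 2)) * (KR * ε) := by
      have hA : 0 ≤ ((n : ℝ) + 1) * ((d * (L - 1) : ℕ) * (KR * ε)) := by positivity
      calc ((1 + KR * ε) ^ (d * (L - 1))) ^ (n + 1) - 1
          ≤ ((n + 1 : ℕ) : ℝ) * ((1 + KR * ε) ^ (d * (L - 1)) - 1) * ((1 + KR * ε) ^ (d * (L - 1))) ^ (n + 1) := h1
        _ ≤ ((n + 1 : ℕ) : ℝ) * ((d * (L - 1) : ℕ) * (KR * ε) * (1 + KR * ε) ^ (d * (L - 1))) * ((1 + KR * ε) ^ (d * (L - 1))) ^ (n + 1) := by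
            gcongr
        _ = ((n : ℝ) + 1) * ((d * (L - 1) : ℕ) * (KR * ε)) * (((1 + KR * ε) ^ (d * (L - 1))) ^ (n + 1) * (1 + KR * ε) ^ (d * (L - 1))) := by
            push_cast; ring
        _ ≤ ((n : ℝ) + 1) * ((d * (L - 1) : ℕ) * (KR * ε)) * (2 : ℝ) ^ (d * (L - 1) * (n + 2)) := mul_le_mul_of_nonneg_left h3 hA
        _ = ((n : ℝ) + 1) * (d * (L - 1) : ℕ) * 2 ^ (d * (L - 1) * (n + 2)) * (KR * ε) := by ring
    have hinv : 0 ≤ (Real.sqrt c₀)⁻¹ := by positivity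
    calc (((1 + KR * ε) ^ (d * (L - 1))) ^ (n + 1) - 1) * (Real.sqrt c₀)⁻¹
        ≤ (((n : ℝ) + 1) * (d * (L - 1) : ℕ) * 2 ^ (d * (L - 1) * (n + 2)) * (KR * ε)) * (Real.sqrt c₀)⁻¹ :=
          mul_le_mul_of_nonneg_right h4 hinv
      _ = ((n : ℝ) + 1) * (d * (L - 1) : ℕ) * 2 ^ (d * (L - 1) * (n + 2)) * (Real.sqrt c₀)⁻¹ * (KR * ε) := by ring
  have hρ'V : ∀ (V : Bond d (towerP L m (n + 1)) → 𝔸ˣ),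
      (∀ (j : ℕ) (b : Bond d (towerP L m (j + 1))), UlevOf L m (n + 1) V j b ∈ U1 𝔸) →
      (∀ (j : ℕ) (b : Bond d (towerP L m (j + 1))), ‖((UlevOf L m (n + 1) V j b : 𝔸ˣ) : 𝔸) - 1‖ ≤ ε) →
      ∀ l : SiteL2K ℂ d (towerP L m (n + 1)) c₀ W,
        ‖QprimeTowerW L m n φ V l - QprimeTowerW L m n φ (fun _ : Bond d (towerP L m (n + 1)) => (1 : 𝔸ˣ)) l‖ ≤ Cρ * (KR * ε) * ‖l‖ := by
    intro V hVLb hVLε l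
    have h := norm_QprimeTowerW_sub_flat_le L m n φ hMφ hMφ' hφ hφ' V hε hVLε hVLb l
    have e : 2 * Mφ * Mφ' * ε = KR * ε := by rw [hKRdef]
    rw [e] at h
    refine h.trans ?_
    rw [← mul_assoc]
    exact mul_le_mul_of_nonneg_right hmaj1 (norm_nonneg _)
  have hρ0 : 0 ≤ Cρ * (KR * ε) := by positivity
  have hCQε0 : 0 ≤ CQ * ε := by positivity
  -- the small-field sum conditions `ε + ρ′ + δ_Q ≤ ε₃a, ε₃b, ε₅`
  have hsum_of : ∀ {t : ℝ}, ε ≤ t / (Cρ * KR + CQ + 2) → ε + Cρ * (KR * ε) + CQ * ε ≤ t := fun {t} ht => by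
    have h1 : ε + Cρ * (KR * ε) + CQ * ε = (Cρ * KR + CQ + 1) * ε := by ring
    rw [h1]
    have h2 : (Cρ * KR + CQ + 1) * ε ≤ (Cρ * KR + CQ + 2) * ε := by nlinarith
    have h3 : (Cρ * KR + CQ + 2) * ε ≤ t := by
      have := mul_le_mul_of_nonneg_left ht (by positivity : (0 : ℝ) ≤ Cρ * KR + CQ + 2)
      rwa [mul_div_cancel₀ _ (by positivity : (Cρ * KR + CQ + 2) ≠ 0)] at this
    exact h2.trans h3
  have hsuma : ε + Cρ * (KR * ε) + CQ * ε ≤ ε₃a := (hsum_of hεε₃').trans (by rw [hε₃def]; exact min_le_left _ _)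
  have hsumb : ε + Cρ * (KR * ε) + CQ * ε ≤ ε₃b := (hsum_of hεε₃').trans (by rw [hε₃def]; exact min_le_right _ _)
  have hsum5 : ε + Cρ * (KR * ε) + CQ * ε ≤ ε₅ := hsum_of hεε₅'
  -- the letters' BOUNDS (at `U` and at `U′`)
  have hcoerU : ∀ x : BondL2K ℂ d (towerP L m (n + 1)) c₀ W, γ₁ * ‖x‖ ^ 2 ≤
      RCLike.re ⟪x, laplaceAk L m n φ η U hL α hα1 hU1 hreg τ (c₀ := c₀) (c₁ := c₁) a x⟫_ℂ := fun x => by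
    have h := Hca U hU1 hreg hε hρ0 hCQε0 hsuma hUb hUε hRS (hρ'V U hLb hLε) (hQdiff U α hα1 hU1 hreg hα2 hLε) x
    have hmin : γ₁ ≤ γa := by rw [hγ₁def]; exact min_le_left _ _
    exact le_trans (mul_le_mul_of_nonneg_right hmin (sq_nonneg _)) h
  have hcoerU' : ∀ x : BondL2K ℂ d (towerP L m (n + 1)) c₀ W, γ₁ * ‖x‖ ^ 2 ≤
      RCLike.re ⟪x, laplaceAk L m n φ η U' hL α' hα1' hU1' hreg' τ (c₀ := c₀) (c₁ := c₁) a x⟫_ℂ := fun x => by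
    have h := Hcb U' hU1' hreg' hε hρ0 hCQε0 hsumb hU'b hU'ε hRS' (hρ'V U' hL'b hL'ε) (hQdiff U' α' hα1' hU1' hreg' hα2' hL'ε) x
    have hmin : γ₁ ≤ γb := by rw [hγ₁def]; exact min_le_right _ _
    exact le_trans (mul_le_mul_of_nonneg_right hmin (sq_nonneg _)) h
  have hG₁le : ∀ z : BondL2K ℂ d (towerP L m (n + 1)) c₀ W,
      ‖G1LatticeK (Δ₁ := hessOp φ η U τ) (Q := QkW L m n φ U hL α hα1 hU1 hreg (c₀ := c₀) (c₁ := c₁)) hpos z‖ ≤ γ₁⁻¹ * ‖z‖ :=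
    fun z => norm_G1k_le_of_coercive L m n hL φ (c₀ := c₀) (c₁ := c₁) α hα1 τ hγ₁ U hU1 hreg hcoerU hpos z
  have hG₂le : ∀ z : BondL2K ℂ d (towerP L m (n + 1)) c₀ W,
      ‖G1LatticeK (Δ₁ := hessOp φ η U' τ) (Q := QkW L m n φ U' hL α' hα1' hU1' hreg' (c₀ := c₀) (c₁ := c₁)) hpos' z‖ ≤ γ₁⁻¹ * ‖z‖ :=
    fun z => norm_G1k_le_of_coercive L m n hL φ (c₀ := c₀) (c₁ := c₁) α' hα1' τ hγ₁ U' hU1' hreg' hcoerU' hpos' z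
  have hH₂le : ∀ b : BondL2K ℂ d m c₁ W,
      ‖H1LatticeK (Δ₁ := hessOp φ η U' τ) (Q := QkW L m n φ U' hL α' hα1' hU1' hreg' (c₀ := c₀) (c₁ := c₁)) hpos' hQs' b‖ ≤ CH * ‖b‖ :=
    fun b => (Hb U' hU1' hreg' hε hρ0 hCQε0 hsum5 hU'b hU'ε hRS' (hρ'V U' hL'b hL'ε) (hQdiff U' α' hα1' hU1' hreg' hα2' hL'ε) hpos' hQs').1 b
  have hD₁le : ∀ s : SiteL2K ℂ d (towerP L m (n + 1)) c₀ W, ‖covDerivL2K ℂ c₀ ((η : ℂ))⁻¹ (adTransportW φ U) s‖ ≤ MD * ‖s‖ := fun s => by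
    rw [hMDdef]; exact norm_covDerivL2K_le _ zero_le_one hR1 s
  have hD₂le : ∀ s : SiteL2K ℂ d (towerP L m (n + 1)) c₀ W, ‖covDerivL2K ℂ c₀ ((η : ℂ))⁻¹ (adTransportW φ U') s‖ ≤ MD * ‖s‖ := fun s => by
    rw [hMDdef]; exact norm_covDerivL2K_le _ zero_le_one hR'1 s
  have hDs₁le : ∀ x : BondL2K ℂ d (towerP L m (n + 1)) c₀ W, ‖covDivL2K ℂ c₀ ((η : ℂ))⁻¹ (adTransportW φ fun b => (U b)⁻¹) x‖ ≤ MD * ‖x‖ :=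
    fun x => by rw [hMDdef]; exact norm_covDivL2K_le _ hc zero_le_one hR1 hRS x
  have hDs₂le : ∀ x : BondL2K ℂ d (towerP L m (n + 1)) c₀ W, ‖covDivL2K ℂ c₀ ((η : ℂ))⁻¹ (adTransportW φ fun b => (U' b)⁻¹) x‖ ≤ MD * ‖x‖ :=
    fun x => by rw [hMDdef]; exact norm_covDivL2K_le _ hc zero_le_one hR'1 hRS' x
  have hRr₁ : ∀ s : SiteL2K ℂ d (towerP L m (n + 1)) c₀ W, ‖RofUk L m n φ η U s‖ ≤ ‖s‖ := fun s => by
    unfold RofUk RLatticeK; exact norm_projR_le _ _ s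
  have hRr₂ : ∀ s : SiteL2K ℂ d (towerP L m (n + 1)) c₀ W, ‖RofUk L m n φ η U' s‖ ≤ ‖s‖ := fun s => by
    unfold RofUk RLatticeK; exact norm_projR_le _ _ s
  -- the letters' DIFFERENCES
  obtain ⟨hGsub, hHsub⟩ := HGH U U' hU1 hreg hα2 hα128 hU1' hreg' hα2' hα128' hε hεε₇ hδ hUb hU'b hUε hU'ε hUU' hRS hRS' hLb hL'b hLε hL'ε hLL'
    hpos hQs hpos' hQs'
  have hQsub : ∀ x : BondL2K ℂ d (towerP L m (n + 1)) c₀ W, ‖QkW L m n φ U hL α hα1 hU1 hreg (c₀ := c₀) (c₁ := c₁) x -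
      QkW L m n φ U' hL α' hα1' hU1' hreg' (c₀ := c₀) (c₁ := c₁) x‖ ≤ CQ₂ * δ * ‖x‖ := fun x => by
    refine (norm_QkW_sub_QkW_le L m n hL φ hMφ hMφ' hφ hφ' U U' α hα1 hU1 hreg hα2 α' hα1' hU1' hreg' hα2' hα128' hL'b hδ₀ hδ₀N hLL'₀
      (c₁ := c₁) x).trans ?_
    have h1 : Mφ' * Mφ * Real.sqrt (c₁ * Fintype.card (Bond d m) / c₀) *
        (((n : ℝ) + 1) * 2 ^ (n + 1) * (75497472 * ((d : ℝ) + 1) * ((2 * (d * L) + L + L : ℕ) : ℝ) * δ₀)) * ‖x‖ = CQ₂ * δ₀ * ‖x‖ := by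
      rw [hCQ₂def, hNdef]; ring
    rw [h1]
    exact mul_le_mul_of_nonneg_right (mul_le_mul_of_nonneg_left hδ₀δ hCQ₂) (norm_nonneg _)
  have hDsub : ∀ s : SiteL2K ℂ d (towerP L m (n + 1)) c₀ W,
      ‖covDerivL2K ℂ c₀ ((η : ℂ))⁻¹ (adTransportW φ U) s - covDerivL2K ℂ c₀ ((η : ℂ))⁻¹ (adTransportW φ U') s‖ ≤ KD * δ * ‖s‖ := fun s => by
    have h := norm_covDerivL2K_sub_le₂ ((η : ℂ))⁻¹ (show 0 ≤ KR * δ by positivity) hRR' s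
    rw [hKDdef]; refine h.trans (le_of_eq ?_); ring
  have hDssub : ∀ x : BondL2K ℂ d (towerP L m (n + 1)) c₀ W,
      ‖covDivL2K ℂ c₀ ((η : ℂ))⁻¹ (adTransportW φ fun b => (U b)⁻¹) x - covDivL2K ℂ c₀ ((η : ℂ))⁻¹ (adTransportW φ fun b => (U' b)⁻¹) x‖ ≤
        KD * δ * ‖x‖ := fun x => by
    have h := norm_covDivL2K_sub_le₂ ((η : ℂ))⁻¹ hc (show 0 ≤ KR * δ by positivity) hRR' hRS hRS' x
    rw [hKDdef]; refine h.trans (le_of_eq ?_); ring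
  have hRsub : ∀ s : SiteL2K ℂ d (towerP L m (n + 1)) c₀ W, ‖RofUk L m n φ η U s - RofUk L m n φ η U' s‖ ≤ CR * δ * ‖s‖ :=
    fun s => HR U U' hε hεεR₀ hδ hUb hU'b hUε hU'ε hUU' hRS hRS' hLb hL'b hLε hL'ε hLL' s
  -- the two `𝔊_k`'s in the form of the telescoping lemma (`H₁ = G₁Q†K⁻¹` by `rfl`)
  have eV : ∀ (V : Bond d (towerP L m (n + 1)) → 𝔸ˣ) (β : ℕ → ℝ) (hβ : ∀ j, β j ≤ 1 / 64)
      (hV1 : ∀ (j : ℕ) (x : B7Prop1Explicit.Site d) (κ : Fin d), perCfg (towerP L m (j + 1)) (UlevOf L m (n + 1) V j) x κ ∈ U1 𝔸)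
      (hregV : ∀ (j : ℕ) (y : TSite d (towerP L m j)) (κ : Fin d) (r : Fin d → Fin L),
        ‖((Wcx L (perCfg (towerP L m (j + 1)) (UlevOf L m (n + 1) V j)) (cornerSite L y) κ (boxVec L r) : 𝔸ˣ) : 𝔸) - 1‖ ≤ β j)
      (hposV : ∀ x : BondL2K ℂ d (towerP L m (n + 1)) c₀ W, x ≠ 0 →
          0 < RCLike.re ⟪x, laplaceAk L m n φ η V hL β hβ hV1 hregV τ (c₀ := c₀) (c₁ := c₁) a x⟫_ℂ)
      (hQV' : Function.Surjective (QkW L m n φ V hL β hβ hV1 hregV (c₀ := c₀) (c₁ := c₁))),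
      frakGLatticeK (Δ₁ := hessOp φ η V τ) (Q := QkW L m n φ V hL β hβ hV1 hregV (c₀ := c₀) (c₁ := c₁)) hposV hQV' x =
      G1LatticeK (Δ₁ := hessOp φ η V τ) (Q := QkW L m n φ V hL β hβ hV1 hregV (c₀ := c₀) (c₁ := c₁)) hposV x -
        H1LatticeK (Δ₁ := hessOp φ η V τ) (Q := QkW L m n φ V hL β hβ hV1 hregV (c₀ := c₀) (c₁ := c₁)) hposV hQV'
          (QkW L m n φ V hL β hβ hV1 hregV (c₀ := c₀) (c₁ := c₁)
            (G1LatticeK (Δ₁ := hessOp φ η V τ) (Q := QkW L m n φ V hL β hβ hV1 hregV (c₀ := c₀) (c₁ := c₁)) hposV x)) -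
        G1LatticeK (Δ₁ := hessOp φ η V τ) (Q := QkW L m n φ V hL β hβ hV1 hregV (c₀ := c₀) (c₁ := c₁)) hposV
          (covDerivL2K ℂ c₀ ((η : ℂ))⁻¹ (adTransportW φ V) (RofUk L m n φ η V (covDivL2K ℂ c₀ ((η : ℂ))⁻¹ (adTransportW φ fun b => (V b)⁻¹)
            (G1LatticeK (Δ₁ := hessOp φ η V τ) (Q := QkW L m n φ V hL β hβ hV1 hregV (c₀ := c₀) (c₁ := c₁)) hposV x)))) := by
    intro V β hβ hV1 hregV hposV hQV'
    unfold frakGLatticeK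
    rw [B11Eq111FrakG.frakGLin_apply]
    rfl
  rw [eV U α hα1 hU1 hreg hpos hQs, eV U' α' hα1' hU1' hreg' hpos' hQs']
  refine (norm_frakG_formula_sub_le (𝕜 := ℂ) _ _ _ _ _ _ _ _ _ _ _ _ (by positivity) hCH.le (by positivity) hMD (by positivity) (by positivity)
    (by positivity) (by positivity) (by positivity) hG₁le hG₂le hH₂le hQU hQU' hD₁le hD₂le hDs₁le hDs₂le hRr₁ hRr₂ hGsub hHsub hQsub hDsub
    hDssub hRsub x).trans (le_of_eq ?_)
  ring

end Literature.MathematicalPhysics.QuantumFieldTheory.Balaban1983to89.B9Eq3153FrakGkLipschitzTowerTwoBackgrounds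

end
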